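import Summits.SmoothPoincare4.SmoothPoincare4.Theorems.SullivanDualTargetOfCruxes
import Summits.SmoothPoincare4.SmoothPoincare4.Theorems.SullivanDualWitnessChargeOfPencilFacts
import Summits.SmoothPoincare4.SmoothPoincare4.Theorems.SullivanDualTargetIffSummit
import Summits.SmoothPoincare4.SmoothPoincare4.Theorems.SullivanDualGromovChartFormOfRecognition
import Summits.SmoothPoincare4.SmoothPoincare4.Theorems.SullivanDualHyperbolicEndSPC4Case

/-!
# SmoothPoincare4 / SullivanDual — the crux `Target` is DERIVED from the route's open leaves

Crux `stmt-SmoothPoincare4-7823` (`Theses.SullivanDual.Target`), line lead c7 (route re-audit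
HONEST-BET-1LEAF). After the route-choice repair of 2026-08-17 every derivation step between the
crux and the route's remaining open leaves is a LANDED theorem:

* `targetOfCruxes_proof : WitnessCharge → HyperbolicEnd → Target` (item 7831, closed);
* `witnessChargeOfPencilFacts_proof : PencilLocalFamily → LimitOfEmbeddedPlanes → WitnessCharge`
  (item 16810, closed; ≈ 90 files of line `Sketch` of `WitnessCharge`);
* `gromovChartFormOfRecognition_proof : GromovRecognitionRelEnd → GromovChartForm` (item 15196, closed);
* the supports `ClosedModelExtension` (7829), `RelativeSullivanDuality` (7827),
  `SympcapGlueChartStandardEnd` (0443), `Spc4ReductionHomotopySphere` (0374) are closed, so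
  `smoothPoincare4_of_target : GromovChartForm → Target → SmoothPoincare4` is unconditional glue;
* `hyperbolicEnd_of_forall_nonempty_diffeomorph_sphere` (line `Sketch` of `HyperbolicEnd`).

This file composes them, so that the planner can REWIRE the deciding theorem and `Target` stops
being an underived leaf:

* `target_of_routeLeaves : HyperbolicEnd → PencilLocalFamily → LimitOfEmbeddedPlanes → Target`
  (= the registered glue stub `helper_targetOfRouteLeaves` of skeleton v5 of line
  `crofton-pencil-laminar-charge`, whose three other stubs are exactly these route items);
* `closes_rewired : HyperbolicEnd → PencilLocalFamily → LimitOfEmbeddedPlanes →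
  GromovRecognitionRelEnd → SmoothPoincare4` — the candidate deciding theorem over the four open
  leaves only (one conjecture-grade: `HyperbolicEnd`; three known theorems carried as debts:
  Wendl 2018 Prop. 2.53, McDuff 1991 §4, McDuff–Salamon 2017 Rem. 4.5.2 (viii));
* `closes_rewired_listed` — the same with the five listed supports kept as hypotheses (the exact
  shape of `Theses.SullivanDual.closes` with `Target` replaced by the three leaves);
* `hyperbolicEnd_of_smoothPoincare4 : SmoothPoincare4 → HyperbolicEnd` (unconditional), hence
  `hyperbolicEnd_iff_smoothPoincare4`, `target_iff_hyperbolicEnd` and `hyperbolicEnd_of_target`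
  modulo the debts: on this route the cruxes `Target` (7823) and `HyperbolicEnd` (7825) and the
  summit are ONE statement modulo known theorems;
* the negative side: `exists_isEmpty_diffeomorph_sphere_of_not_hyperbolicEnd` (unconditional) and
  `not_hyperbolicEnd_of_not_target` (modulo the two pencil debts).

No analysis enters; every statement is composition of landed theorems.
-/

noncomputable section

-- the registered namespace `Summit.SmoothPoincare4.SmoothPoincare4.Theorems` repeats a component
set_option linter.dupNamespace false

open scoped Manifold ContDiff Topology
open Literature.Topology.FourManifolds
open Summit.SmoothPoincare4.SmoothPoincare4.Theses.SullivanDual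

namespace Summit.SmoothPoincare4.SmoothPoincare4.Theorems

namespace SullivanDual

/-! ### The crux from the open leaves -/

/-- **`Target` from the route's open leaves** `HyperbolicEnd` (crux 7825), `PencilLocalFamily`
(crux 16772, Wendl 2018 Prop. 2.53) and `LimitOfEmbeddedPlanes` (item 16809, McDuff 1991 §4):
compose the landed `witnessChargeOfPencilFacts_proof` (16810) with `targetOfCruxes_proof` (7831).
Pure logic. [folklore] -/
theorem target_of_routeLeaves (hHE : HyperbolicEnd) (hP : PencilLocalFamily)
    (hL : LimitOfEmbeddedPlanes) : Target :=
  targetOfCruxes_proof (witnessChargeOfPencilFacts_proof hP hL) hHE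

/-- **Registered glue stub `helper_targetOfRouteLeaves` of line `crofton-pencil-laminar-charge`
(skeleton v5, crux stmt-SmoothPoincare4-7823)** — verbatim the registered signature; the same
statement as `target_of_routeLeaves`. [folklore] -/
theorem helper_targetOfRouteLeaves : Summit.SmoothPoincare4.SmoothPoincare4.Theses.SullivanDual.HyperbolicEnd → Summit.SmoothPoincare4.SmoothPoincare4.Theses.SullivanDual.PencilLocalFamily → Summit.SmoothPoincare4.SmoothPoincare4.Theses.SullivanDual.LimitOfEmbeddedPlanes → Summit.SmoothPoincare4.SmoothPoincare4.Theses.SullivanDual.Target :=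
  fun hHE hP hL => target_of_routeLeaves hHE hP hL

/-- **`WitnessCharge ∧ HyperbolicEnd → Target`** restated with the cruxes in the order of their
ranks (7824, 7825), for citation. [folklore] -/
theorem target_of_witnessCharge_of_hyperbolicEnd (hWC : WitnessCharge) (hHE : HyperbolicEnd) :
    Target :=
  targetOfCruxes_proof hWC hHE

/-! ### The rewired deciding theorem -/

/-- **Candidate deciding theorem over the open leaves only**:
`HyperbolicEnd → PencilLocalFamily → LimitOfEmbeddedPlanes → GromovRecognitionRelEnd → SmoothPoincare4`.
The listed supports `ClosedModelExtension`, `RelativeSullivanDuality`, `GromovChartForm`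
(from `GromovRecognitionRelEnd` by `gromovChartFormOfRecognition_proof`),
`SympcapGlueChartStandardEnd` and `Spc4ReductionHomotopySphere` are discharged by their landed
proofs inside `smoothPoincare4_of_target`. [folklore] -/
theorem closes_rewired (hHE : HyperbolicEnd) (hP : PencilLocalFamily) (hL : LimitOfEmbeddedPlanes)
    (hGR : GromovRecognitionRelEnd) : _root_.SmoothPoincare4 :=
  smoothPoincare4_of_target (gromovChartFormOfRecognition_proof hGR) (target_of_routeLeaves hHE hP hL)

/-- **Candidate deciding theorem in the shape of `Theses.SullivanDual.closes`** with the
hypothesis `Target` replaced by the three leaves it is derived from and every listed support kept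
as a hypothesis (so that a route edit can adopt it verbatim). [folklore] -/
theorem closes_rewired_listed (hHE : HyperbolicEnd) (hP : PencilLocalFamily)
    (hL : LimitOfEmbeddedPlanes) (hCME : ClosedModelExtension) (hRSD : RelativeSullivanDuality)
    (hG : GromovChartForm) (hGlue : SympcapGlueChartStandardEnd)
    (hRed : Spc4ReductionHomotopySphere) : _root_.SmoothPoincare4 :=
  closes (target_of_routeLeaves hHE hP hL) hCME hRSD hG hGlue hRed

/-- **The same with the Gromov debt in its promoted form** `GromovRecognitionRelEnd` (crux 11009)
instead of the chart form. [folklore] -/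
theorem closes_rewired_listed' (hHE : HyperbolicEnd) (hP : PencilLocalFamily)
    (hL : LimitOfEmbeddedPlanes) (hCME : ClosedModelExtension) (hRSD : RelativeSullivanDuality)
    (hGR : GromovRecognitionRelEnd) (hGlue : SympcapGlueChartStandardEnd)
    (hRed : Spc4ReductionHomotopySphere) : _root_.SmoothPoincare4 :=
  closes (target_of_routeLeaves hHE hP hL) hCME hRSD (gromovChartFormOfRecognition_proof hGR) hGlue hRed

/-! ### `HyperbolicEnd`, `Target` and the summit are one statement modulo the debts -/

/-- **`SmoothPoincare4 → HyperbolicEnd`** (unconditional): every homotopy 4-sphere is then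
diffeomorphic to `S⁴` (`nonempty_diffeomorph_sphere_of_smoothPoincare4`), and the crux holds at
every such sphere (`hyperbolicEnd_of_forall_nonempty_diffeomorph_sphere`: the model hyperbolic
pair pulled back by Palais' chart form, Ahlfors–Osserman). [folklore] -/
theorem hyperbolicEnd_of_smoothPoincare4 (h : _root_.SmoothPoincare4) : HyperbolicEnd :=
  Cruxes.HyperbolicEnd.Sketch.hyperbolicEnd_of_forall_nonempty_diffeomorph_sphere
    (nonempty_diffeomorph_sphere_of_smoothPoincare4 h)

/-- **`HyperbolicEnd ↔ SmoothPoincare4` modulo the three known-theorem debts**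
`PencilLocalFamily`, `LimitOfEmbeddedPlanes`, `GromovRecognitionRelEnd`. [folklore] -/
theorem hyperbolicEnd_iff_smoothPoincare4 (hP : PencilLocalFamily) (hL : LimitOfEmbeddedPlanes)
    (hGR : GromovRecognitionRelEnd) : HyperbolicEnd ↔ _root_.SmoothPoincare4 :=
  ⟨fun hHE => closes_rewired hHE hP hL hGR, hyperbolicEnd_of_smoothPoincare4⟩

/-- **`Target → HyperbolicEnd` given `GromovChartForm`**: through the summit
(`smoothPoincare4_of_target`, then `hyperbolicEnd_of_smoothPoincare4`). [folklore] -/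
theorem hyperbolicEnd_of_target (hG : GromovChartForm) (hT : Target) : HyperbolicEnd :=
  hyperbolicEnd_of_smoothPoincare4 (smoothPoincare4_of_target hG hT)

/-- **`Target ↔ HyperbolicEnd` modulo the debts**: `→` needs only `GromovChartForm`
(here from `GromovRecognitionRelEnd`), `←` needs only the two pencil debts. So the cruxes 7823
and 7825 of route SullivanDual carry the same open content. [folklore] -/
theorem target_iff_hyperbolicEnd (hP : PencilLocalFamily) (hL : LimitOfEmbeddedPlanes)
    (hGR : GromovRecognitionRelEnd) : Target ↔ HyperbolicEnd :=
  ⟨hyperbolicEnd_of_target (gromovChartFormOfRecognition_proof hGR),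
    fun hHE => target_of_routeLeaves hHE hP hL⟩

/-- **The three cruxes-or-summit are pairwise equivalent modulo the debts**, packaged:
`(Target ↔ SmoothPoincare4) ∧ (HyperbolicEnd ↔ SmoothPoincare4)`. [folklore] -/
theorem target_hyperbolicEnd_summit_equiv (hP : PencilLocalFamily) (hL : LimitOfEmbeddedPlanes)
    (hGR : GromovRecognitionRelEnd) :
    (Target ↔ _root_.SmoothPoincare4) ∧ (HyperbolicEnd ↔ _root_.SmoothPoincare4) :=
  ⟨target_iff_smoothPoincare4 (gromovChartFormOfRecognition_proof hGR),
    hyperbolicEnd_iff_smoothPoincare4 hP hL hGR⟩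

/-! ### The negative side -/

/-- **If `HyperbolicEnd` fails, some homotopy 4-sphere is exotic** (unconditional contrapositive
of `hyperbolicEnd_of_forall_nonempty_diffeomorph_sphere`). [folklore] -/
theorem exists_isEmpty_diffeomorph_sphere_of_not_hyperbolicEnd (h : ¬ HyperbolicEnd) :
    ∃ S : HomotopySphere 4,
      IsEmpty (S.carrier ≃ₘ⟮𝓡 4, 𝓡 4⟯ Metric.sphere (0 : EuclideanSpace ℝ (Fin 5)) 1) := by
  by_contra hne
  exact h (Cruxes.HyperbolicEnd.Sketch.hyperbolicEnd_of_forall_nonempty_diffeomorph_sphere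
    fun S => not_isEmpty_iff.1 fun hS => hne ⟨S, hS⟩)

/-- **If `HyperbolicEnd` fails, the summit fails** (unconditional). [folklore] -/
theorem not_smoothPoincare4_of_not_hyperbolicEnd (h : ¬ HyperbolicEnd) : ¬ _root_.SmoothPoincare4 :=
  mt hyperbolicEnd_of_smoothPoincare4 h

/-- **If `Target` fails, `HyperbolicEnd` fails, modulo the two pencil debts** (contrapositive of
`target_of_routeLeaves`): an exotic witness structure for every `J` forces, for every boundary-standard
`J`, a bounded entire `J`-curve in the core. [folklore] -/
theorem not_hyperbolicEnd_of_not_target (hP : PencilLocalFamily) (hL : LimitOfEmbeddedPlanes)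
    (h : ¬ Target) : ¬ HyperbolicEnd :=
  fun hHE => h (target_of_routeLeaves hHE hP hL)

end SullivanDual

end Summit.SmoothPoincare4.SmoothPoincare4.Theorems

end
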